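import Summits.BirchSwinnertonDyer.Rank1Residual.GaloisImage.KolyvaginLevelCounting
import HarnessLib

/-!
# The relaxed Selmer groups `H¹_{𝓕^N}(K, T̄)` along the levels of a Kolyvagin system: counting at
# core rank one, and "core-like" levels (cell `b2b-bsdres`, team n1011, ROUTE-1 item R1-56
# "S24(1) @ m = 1 in the kernel", row T-R1-56-S, FILE A = the level bookkeeping of the stalk half)

HONEST FRAMING (verbatim for the cell): research route; prove what is provable now; no claim beyond
stated classes; nothing booked; no mark / label moved.  TOOL theorems about Selmer structures of a
finite Galois module (setting and binders of p11's R1-16 files `KolyvaginLevelStructures` /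
`KolyvaginLevelCounting`); theorems only: no definition, no named fact.

For a level `N` write `𝓕^N := 𝓕.relaxedAt N` (Rubin Def. 2.1.1 `𝓕^b`; Mazur–Rubin's `𝓕^𝔫`),
`W(N) := H¹_{𝓕^N}(K, M)`, `W^*(N) := H¹_{(𝓕^N)^*}(K, M^D)`.  §1: unfolding, `𝓕(n) ≤ 𝓕^N` for
`n ⊆ N` and the membership test for the stalks inside `W(N)` (Mazur–Rubin Def. 8.1 / (gi2));
§2: `W^*(N𝔮) = {y ∈ W^*(N) : loc_𝔮 y = 0}`, finiteness; §3: COUNTING by pair counting at one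
place — `#W(N𝔮)·#W^*(N) = p·#W(N)·#W^*(N𝔮)`, `#W(N)·#H¹_{𝓕^*} = p^{#N}·#H¹_𝓕·#W^*(N)`, and at
core rank one `#W(N) = p^{#N+1}·#W^*(N)` (Mazur–Rubin Cor. 3.5 (ii) at `r = 1`); §4: above every
level there is a CORE-LIKE level (`W^*(N) = 0`; Mazur–Rubin Lemma 6.4 (ii)).  Extra binders:
`hH1 : #H¹(K_𝔮, M) = p²` at `𝔮 ∈ 𝒫` (= p11 G1.1) and the one-class dual prime choice `hprime'`.
Consumer: `KolyvaginStalkExistence.lean`.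

References: B. Mazur, K. Rubin, JTNB 28 (2016) 145–183 (arXiv:1312.4052) Cor. 3.5, Def. 6.1,
Lemma 6.4, Def. 8.1; K. Rubin, PCMI 18 (2011) L. 2, Def. 2.1.1, Ex. 2.1.4, Prop. 2.6.1 (held).
-/

noncomputable section

open scoped Classical NumberField ContRepresentation
open Function NumberField IsDedekindDomain
open Literature.NumberTheory.GaloisRepresentations Literature.NumberTheory.GaloisRepresentations.DiscreteGaloisModule
  Literature.NumberTheory.GaloisCohomology
open Summit.BirchSwinnertonDyer.Rank1Residual.GaloisImage.CoreRankZero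

universe u

namespace Summit.BirchSwinnertonDyer.Rank1Residual.GaloisImage.CoreRankOne.Stalk

variable {K : Type u} [Field K] [NumberField K] {n : ℕ}
variable {M : Type u} [AddCommGroup M] [TopologicalSpace M] [DiscreteTopology M]
variable {ρ : DiscreteGaloisModule K M}

/-! ## §1. The relaxed structure `𝓕^N` at a finite set `N` of finite places -/

section Unfold

variable (𝓕 : SelmerStructure ρ)

/-- `(𝓕^N)_v = H¹(K_v, M)` at `v ∈ N`. [cite: Rubin2011, Def. 2.1.1 (p. 17)] -/
theorem relaxedAt_inr_of_mem {N : Finset (HeightOneSpectrum (𝓞 K))} {v : HeightOneSpectrum (𝓞 K)}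
    (hv : v ∈ N) : 𝓕.relaxedAt N (Sum.inr v) = ⊤ :=
  SelmerStructure.modify_inr_of_mem_relaxed 𝓕 𝓕 hv

/-- `(𝓕^N)_v = 𝓕_v` at a finite place `v ∉ N`. [cite: Rubin2011, Def. 2.1.1 (p. 17)] -/
theorem relaxedAt_inr_of_not_mem {N : Finset (HeightOneSpectrum (𝓞 K))}
    {v : HeightOneSpectrum (𝓞 K)} (hv : v ∉ N) : 𝓕.relaxedAt N (Sum.inr v) = 𝓕 (Sum.inr v) :=
  SelmerStructure.modify_inr_of_not_mem 𝓕 𝓕 hv (Finset.notMem_empty v) (Finset.notMem_empty v)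

/-- `(𝓕^N)_w = 𝓕_w` at an infinite place. [cite: Rubin2011, Def. 2.1.1 (p. 17)] -/
theorem relaxedAt_inl (N : Finset (HeightOneSpectrum (𝓞 K))) (w : InfinitePlace K) :
    𝓕.relaxedAt N (Sum.inl w) = 𝓕 (Sum.inl w) := rfl

/-- `𝓕^N ≤ 𝓕^{N′}` for `N ⊆ N′`. [cite: Rubin2011, Def. 2.1.1 (p. 17)] -/
theorem relaxedAt_mono {N N' : Finset (HeightOneSpectrum (𝓞 K))} (h : N ⊆ N') :
    𝓕.relaxedAt N ≤ 𝓕.relaxedAt N' := by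
  intro v
  cases v with
  | inl w => exact le_rfl
  | inr v =>
    by_cases hv' : v ∈ N'
    · rw [relaxedAt_inr_of_mem 𝓕 hv']; exact le_top
    · rw [relaxedAt_inr_of_not_mem 𝓕 hv', relaxedAt_inr_of_not_mem 𝓕 fun hv => hv' (h hv)]

/-- `𝓕 ≤ 𝓕^N`. [cite: Rubin2011, Def. 2.1.1 (p. 17)] -/
theorem le_relaxedAt (N : Finset (HeightOneSpectrum (𝓞 K))) : 𝓕 ≤ 𝓕.relaxedAt N := by
  have h := relaxedAt_mono 𝓕 (Finset.empty_subset N)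
  rwa [show 𝓕.relaxedAt ∅ = 𝓕 from SelmerStructure.modify_empty 𝓕 𝓕] at h

/-- `𝓕^{N𝔮}` and `𝓕^N` agree off `𝔮`. [cite: Rubin2011, Def. 2.1.1 (p. 17)] -/
theorem relaxedAt_insert_apply_of_ne {N : Finset (HeightOneSpectrum (𝓞 K))}
    (q : HeightOneSpectrum (𝓞 K)) {v : Place K} (hv : v ≠ Sum.inr q) :
    𝓕.relaxedAt (insert q N) v = 𝓕.relaxedAt N v := by
  cases v with
  | inl w => rfl
  | inr v =>
    have hvq : v ≠ q := fun h => hv (by rw [h])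
    by_cases hvN : v ∈ N
    · rw [relaxedAt_inr_of_mem 𝓕 hvN, relaxedAt_inr_of_mem 𝓕 (Finset.mem_insert_of_mem hvN)]
    · rw [relaxedAt_inr_of_not_mem 𝓕 hvN, relaxedAt_inr_of_not_mem 𝓕]
      simp [hvq, hvN]

/-- `(𝓕^{N𝔮})_𝔮 = H¹(K_𝔮, M)`. [cite: Rubin2011, Def. 2.1.1 (p. 17)] -/
theorem relaxedAt_insert_inr_self (N : Finset (HeightOneSpectrum (𝓞 K))) (q : HeightOneSpectrum (𝓞 K)) :
    𝓕.relaxedAt (insert q N) (Sum.inr q) = ⊤ :=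
  relaxedAt_inr_of_mem 𝓕 (Finset.mem_insert_self q N)

/-- `𝓕^N` is unramified outside any `S′ ⊇ S ∪ N` if `𝓕` is unramified outside `S`.
[cite: Rubin2011, Def. 2.1.1 (p. 17)] -/
theorem isUnramifiedOutside_relaxedAt {S : Finset (Place K)} (h𝓕 : 𝓕.IsUnramifiedOutside S)
    (N : Finset (HeightOneSpectrum (𝓞 K))) {S' : Finset (Place K)} (hSS' : S ⊆ S')
    (hN : ∀ q ∈ N, (Sum.inr q : Place K) ∈ S') : (𝓕.relaxedAt N).IsUnramifiedOutside S' := by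
  refine ⟨fun w => hSS' (h𝓕.1 w), fun v hv => ?_⟩
  rw [relaxedAt_inr_of_not_mem 𝓕 fun h => hv (hN v h)]
  exact h𝓕.2 v fun h => hv (hSS' h)

/-- **`𝓕(n) ≤ 𝓕^N` for `n ⊆ N`**: every stalk of the Selmer sheaf below `N` lies in `W(N)`.
[cite: Rubin2011, Def. 2.1.1 (p. 17)] -/
theorem atLevel_le_relaxedAt (D : KolyvaginDatum ρ) {n N : Finset (HeightOneSpectrum (𝓞 K))}
    (hnN : n ⊆ N) : D.atLevel 𝓕 n ≤ 𝓕.relaxedAt N := by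
  intro v
  cases v with
  | inl w => exact le_rfl
  | inr v =>
    by_cases hvN : v ∈ N
    · rw [relaxedAt_inr_of_mem 𝓕 hvN]; exact le_top
    · rw [relaxedAt_inr_of_not_mem 𝓕 hvN, Level.atLevel_inr_of_not_mem D 𝓕 fun h => hvN (hnN h)]

/-- **Membership test for the stalks inside `W(N)`** (Mazur–Rubin Def. 8.1 / (gi2)): for `N` away
from `S`, a class of `H¹_{𝓕^N}(K, M)` lies in `H¹_{𝓕(n)}(K, M)` iff its localisation is transverse
at the places of `n` and unramified at those of `N ∖ n` (intended `n ⊆ N`). [folklore] -/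
theorem mem_selmerGroup_atLevel_iff_of_subset (D : KolyvaginDatum ρ) {S : Finset (Place K)}
    (h𝓕 : 𝓕.IsUnramifiedOutside S) {n N : Finset (HeightOneSpectrum (𝓞 K))}
    (hNS : ∀ q ∈ N, (Sum.inr q : Place K) ∉ S) {x : galoisCohomology ρ 1}
    (hx : x ∈ (𝓕.relaxedAt N).selmerGroup) :
    x ∈ (D.atLevel 𝓕 n).selmerGroup ↔
      (∀ q ∈ n, galoisCohomology.localization ρ (Sum.inr q) 1 x ∈ D.transverse (Sum.inr q)) ∧
        ∀ q ∈ N, q ∉ n →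
          galoisCohomology.localization ρ (Sum.inr q) 1 x ∈ unramifiedSubgroup (GaloisRep.toLocal q ρ) 1 := by
  rw [SelmerStructure.mem_selmerGroup_iff] at hx ⊢
  constructor
  · intro h
    refine ⟨fun q hq => ?_, fun q hqN hqn => ?_⟩
    · have := h (Sum.inr q); rwa [Level.atLevel_inr_of_mem D 𝓕 hq] at this
    · have := h (Sum.inr q)
      rwa [Level.atLevel_inr_of_not_mem D 𝓕 hqn, h𝓕.2 q (hNS q hqN)] at this
  · rintro ⟨ht, hu⟩ v
    cases v with
    | inl w => rw [Level.atLevel_inl]; exact hx (Sum.inl w)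
    | inr v =>
      by_cases hvn : v ∈ n
      · rw [Level.atLevel_inr_of_mem D 𝓕 hvn]; exact ht v hvn
      · rw [Level.atLevel_inr_of_not_mem D 𝓕 hvn]
        by_cases hvN : v ∈ N
        · rw [h𝓕.2 v (hNS v hvN)]; exact hu v hvN hvn
        · have := hx (Sum.inr v); rwa [relaxedAt_inr_of_not_mem 𝓕 hvN] at this

end Unfold

/-! ## §2. The dual side: `W^*(N𝔮) = {y ∈ W^*(N) : loc_𝔮 y = 0}`, finiteness -/

section Dual

variable [Finite M]

/-- **`H¹_{(𝓕^{N𝔮})^*} = {y ∈ H¹_{(𝓕^N)^*} : loc_𝔮 y = 0}`**: relaxing at `𝔮` makes the dual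
structure strict at `𝔮` (`(H¹(K_𝔮, M))^* = 0` by perfectness). [folklore] -/
theorem mem_dualSelmerGroup_relaxedAt_insert_iff {inv : LocalInvariants K n} (hperf : inv.IsPerfect)
    (hM : ∀ m : M, n • m = 0) (𝓕 : SelmerStructure ρ) (N : Finset (HeightOneSpectrum (𝓞 K)))
    (q : HeightOneSpectrum (𝓞 K)) (y : galoisCohomology (ρ.tateDual n) 1) :
    y ∈ (inv.dualSelmerStructure ρ (𝓕.relaxedAt (insert q N))).selmerGroup ↔
      y ∈ (inv.dualSelmerStructure ρ (𝓕.relaxedAt N)).selmerGroup ∧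
        galoisCohomology.localization (ρ.tateDual n) (Sum.inr q) 1 y = 0 := by
  rw [SelmerStructure.mem_selmerGroup_iff, SelmerStructure.mem_selmerGroup_iff]
  constructor
  · intro h
    have hq : galoisCohomology.localization (ρ.tateDual n) (Sum.inr q) 1 y = 0 := by
      have := h (Sum.inr q)
      rwa [LocalInvariants.dualSelmerStructure_apply, relaxedAt_insert_inr_self,
        dualLocalCondition_top_of_isPerfect hperf ρ hM q, AddSubgroup.mem_bot] at this
    refine ⟨fun v => ?_, hq⟩
    by_cases hv : v = Sum.inr q
    · subst hv; rw [hq]; exact zero_mem _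
    · have := h v
      rwa [LocalInvariants.dualSelmerStructure_apply, relaxedAt_insert_apply_of_ne 𝓕 q hv,
        ← LocalInvariants.dualSelmerStructure_apply] at this
  · rintro ⟨h, hq⟩ v
    by_cases hv : v = Sum.inr q
    · subst hv; rw [hq]; exact zero_mem _
    · rw [LocalInvariants.dualSelmerStructure_apply, relaxedAt_insert_apply_of_ne 𝓕 q hv,
        ← LocalInvariants.dualSelmerStructure_apply]
      exact h v

/-- Core-likeness ascends from `N` to every `N′ ⊇ N` (the dual side only gets stricter). [folklore] -/
theorem dualSelmerGroup_relaxedAt_eq_bot_mono (inv : LocalInvariants K n) (𝓕 : SelmerStructure ρ)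
    {N N' : Finset (HeightOneSpectrum (𝓞 K))} (h : N ⊆ N')
    (hN : (inv.dualSelmerStructure ρ (𝓕.relaxedAt N)).selmerGroup = ⊥) :
    (inv.dualSelmerStructure ρ (𝓕.relaxedAt N')).selmerGroup = ⊥ :=
  eq_bot_iff.mpr (hN ▸ LocalInvariants.selmerGroup_dualSelmerStructure_anti inv ρ (relaxedAt_mono 𝓕 h))

/-- `W(N) = H¹_{𝓕^N}(K, M)` is finite when `H¹_𝓕(K, M)` is. [folklore] -/
theorem finite_selmerGroup_relaxedAt (𝓕 : SelmerStructure ρ) (hfin : Finite 𝓕.selmerGroup)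
    (N : Finset (HeightOneSpectrum (𝓞 K))) : Finite (𝓕.relaxedAt N).selmerGroup := by
  refine finite_selmerGroup_of_le_off N (fun v hv => le_of_eq ?_) hfin
  cases v with
  | inl w => rfl
  | inr v => exact relaxedAt_inr_of_not_mem 𝓕 fun h => hv v h rfl

/-- `W^*(N)` is finite when `H¹_{𝓕^*}(K, M^D)` is (it is a subgroup). [folklore] -/
theorem finite_dualSelmerGroup_relaxedAt (inv : LocalInvariants K n) (𝓕 : SelmerStructure ρ)
    (hfind : Finite (inv.dualSelmerStructure ρ 𝓕).selmerGroup)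
    (N : Finset (HeightOneSpectrum (𝓞 K))) :
    Finite (inv.dualSelmerStructure ρ (𝓕.relaxedAt N)).selmerGroup :=
  Finite.of_injective
    (fun y : (inv.dualSelmerStructure ρ (𝓕.relaxedAt N)).selmerGroup =>
      (⟨y.1, LocalInvariants.selmerGroup_dualSelmerStructure_anti inv ρ (le_relaxedAt 𝓕 N) y.2⟩ :
        (inv.dualSelmerStructure ρ 𝓕).selmerGroup))
    fun _ _ h => Subtype.ext (congrArg (fun z : (inv.dualSelmerStructure ρ 𝓕).selmerGroup => (z : galoisCohomology (ρ.tateDual n) 1)) h)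

end Dual

/-! ## §3. Counting `W(N)` at core rank one -/

section Counting

variable [Finite M]

/-- **One step: `#W(N𝔮) · #W^*(N) = p · #W(N) · #W^*(N𝔮)`** for a Kolyvagin prime `𝔮 ∉ N`
(`#H¹(K_𝔮, M) = p²`, `#H¹_ur(K_𝔮, M) = p`): pair counting for `𝓕^N ≤ 𝓕^{N𝔮}` at `𝔮`.
[cite: Rubin2011, Prop. 2.6.1 (p. 22)] -/
theorem natCard_selmerGroup_relaxedAt_insert_mul {p : ℕ} [Fact p.Prime] {inv : LocalInvariants K p}
    (hperf : inv.IsPerfect) (hsum : inv.SumLocalTermEqZero) (hcompl : inv.SelmerComplement)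
    (hM : ∀ m : M, p • m = 0) {S : Finset (Place K)}
    (hS : ∀ v : HeightOneSpectrum (𝓞 K), (Sum.inr v : Place K) ∉ S →
      ((p : ℕ) : 𝓞 K) ∉ v.asIdeal ∧ GaloisRep.IsUnramifiedAt v ρ)
    {𝓕 : SelmerStructure ρ} (h𝓕 : 𝓕.IsUnramifiedOutside S)
    {D : KolyvaginDatum ρ} (hPS : ∀ q ∈ D.primes, (Sum.inr q : Place K) ∉ S)
    (hU : ∀ q ∈ D.primes, Nat.card (unramifiedSubgroup (GaloisRep.toLocal q ρ) 1) = p)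
    (hH1 : ∀ q ∈ D.primes, Nat.card (galoisCohomology (GaloisRep.toLocal q ρ) 1) = p ^ 2)
    (N : Finset (HeightOneSpectrum (𝓞 K))) {q : HeightOneSpectrum (𝓞 K)}
    (hq : q ∈ D.primes) (hqN : q ∉ N) :
    Nat.card (𝓕.relaxedAt (insert q N)).selmerGroup *
        Nat.card (inv.dualSelmerStructure ρ (𝓕.relaxedAt N)).selmerGroup =
      p * Nat.card (𝓕.relaxedAt N).selmerGroup *
        Nat.card (inv.dualSelmerStructure ρ (𝓕.relaxedAt (insert q N))).selmerGroup := by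
  classical
  haveI := DiscreteGaloisModule.TateDual.finite K M p
  -- the enlarged set of places `S' = S ∪ N ∪ {𝔮}`
  let S' : Finset (Place K) := S ∪ (insert q N).map ⟨Sum.inr, Sum.inr_injective⟩
  have hSS' : S ⊆ S' := Finset.subset_union_left
  have hNS' : ∀ r ∈ insert q N, (Sum.inr r : Place K) ∈ S' := fun r hr =>
    Finset.mem_union_right _ (Finset.mem_map.2 ⟨r, hr, rfl⟩)
  have hq' : (Sum.inr q : Place K) ∈ S' := hNS' q (Finset.mem_insert_self q N)
  have hS' : ∀ v : HeightOneSpectrum (𝓞 K), (Sum.inr v : Place K) ∉ S' →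
      ((p : ℕ) : 𝓞 K) ∉ v.asIdeal ∧ GaloisRep.IsUnramifiedAt v ρ :=
    fun v hv => hS v fun h => hv (hSS' h)
  -- `𝓐 = 𝓕^N ≤ 𝓑 = 𝓕^{N𝔮}`, equal off `𝔮`
  have h𝓐 : (𝓕.relaxedAt N).IsUnramifiedOutside S' :=
    isUnramifiedOutside_relaxedAt 𝓕 h𝓕 N hSS' fun r hr => hNS' r (Finset.mem_insert_of_mem hr)
  have h𝓑 : (𝓕.relaxedAt (insert q N)).IsUnramifiedOutside S' :=
    isUnramifiedOutside_relaxedAt 𝓕 h𝓕 (insert q N) hSS' hNS'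
  have hle : 𝓕.relaxedAt N ≤ 𝓕.relaxedAt (insert q N) := relaxedAt_mono 𝓕 (Finset.subset_insert q N)
  have heq : ∀ v : Place K, v ≠ Sum.inr q → 𝓕.relaxedAt N v = 𝓕.relaxedAt (insert q N) v :=
    fun v hv => (relaxedAt_insert_apply_of_ne 𝓕 q hv).symm
  have P := card_selmerGroup_pair_one_place hperf hsum hcompl hM hS' hle h𝓐 h𝓑 q hq' heq
  -- the local indices: `#(𝓕^N)_𝔮 = #H¹_ur = p`, `#(𝓕^{N𝔮})_𝔮 = #H¹(K_𝔮, M) = p²`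
  have hAq : Nat.card (𝓕.relaxedAt N (Sum.inr q)) = p := by
    rw [relaxedAt_inr_of_not_mem 𝓕 hqN, h𝓕.2 q (hPS q hq)]; exact hU q hq
  have hBq : Nat.card (𝓕.relaxedAt (insert q N) (Sum.inr q)) = p ^ 2 := by
    rw [relaxedAt_insert_inr_self, AddSubgroup.card_top]; exact hH1 q hq
  rw [hAq, hBq] at P
  have hp : p ≠ 0 := (Fact.out : p.Prime).ne_zero
  refine mul_right_cancel₀ hp ?_
  calc Nat.card (𝓕.relaxedAt (insert q N)).selmerGroup *
        Nat.card (inv.dualSelmerStructure ρ (𝓕.relaxedAt N)).selmerGroup * p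
      = Nat.card (𝓕.relaxedAt N).selmerGroup *
          Nat.card (inv.dualSelmerStructure ρ (𝓕.relaxedAt (insert q N))).selmerGroup * p ^ 2 := P
    _ = p * Nat.card (𝓕.relaxedAt N).selmerGroup *
          Nat.card (inv.dualSelmerStructure ρ (𝓕.relaxedAt (insert q N))).selmerGroup * p := by ring

/-- **`#W(N) · #H¹_{𝓕^*} = p^{#N} · #H¹_𝓕 · #W^*(N)`** for every level `N` (iterate the one-step
identity; Rubin Ex. 2.1.4 at `m = 1`). [cite: Rubin2011, Exercise 2.1.4 (p. 18)] -/
theorem natCard_selmerGroup_relaxedAt_mul {p : ℕ} [Fact p.Prime] {inv : LocalInvariants K p}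
    (hperf : inv.IsPerfect) (hsum : inv.SumLocalTermEqZero) (hcompl : inv.SelmerComplement)
    (hM : ∀ m : M, p • m = 0) {S : Finset (Place K)}
    (hS : ∀ v : HeightOneSpectrum (𝓞 K), (Sum.inr v : Place K) ∉ S →
      ((p : ℕ) : 𝓞 K) ∉ v.asIdeal ∧ GaloisRep.IsUnramifiedAt v ρ)
    {𝓕 : SelmerStructure ρ} (h𝓕 : 𝓕.IsUnramifiedOutside S)
    (hfin : Finite 𝓕.selmerGroup) (hfind : Finite (inv.dualSelmerStructure ρ 𝓕).selmerGroup)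
    {D : KolyvaginDatum ρ} (hPS : ∀ q ∈ D.primes, (Sum.inr q : Place K) ∉ S)
    (hU : ∀ q ∈ D.primes, Nat.card (unramifiedSubgroup (GaloisRep.toLocal q ρ) 1) = p)
    (hH1 : ∀ q ∈ D.primes, Nat.card (galoisCohomology (GaloisRep.toLocal q ρ) 1) = p ^ 2)
    {N : Finset (HeightOneSpectrum (𝓞 K))} (hN : D.IsLevel N) :
    Nat.card (𝓕.relaxedAt N).selmerGroup * Nat.card (inv.dualSelmerStructure ρ 𝓕).selmerGroup =
      p ^ N.card * Nat.card 𝓕.selmerGroup *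
        Nat.card (inv.dualSelmerStructure ρ (𝓕.relaxedAt N)).selmerGroup := by
  classical
  induction N using Finset.induction_on with
  | empty =>
    rw [show 𝓕.relaxedAt ∅ = 𝓕 from SelmerStructure.modify_empty 𝓕 𝓕, Finset.card_empty, pow_zero,
      one_mul]
  | insert q N hqN ih =>
    have hN' : D.IsLevel N ∧ q ∈ D.primes := by
      simp only [KolyvaginDatum.IsLevel, Finset.coe_insert, Set.insert_subset_iff] at hN
      exact ⟨hN.2, hN.1⟩
    have step := natCard_selmerGroup_relaxedAt_insert_mul hperf hsum hcompl hM hS h𝓕 hPS hU hH1 N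
      hN'.2 hqN
    have ih' := ih hN'.1
    haveI := finite_selmerGroup_relaxedAt 𝓕 hfin N
    haveI := finite_dualSelmerGroup_relaxedAt inv 𝓕 hfind N
    have hW : Nat.card (𝓕.relaxedAt N).selmerGroup ≠ 0 := Nat.card_pos.ne'
    have hWs : Nat.card (inv.dualSelmerStructure ρ (𝓕.relaxedAt N)).selmerGroup ≠ 0 :=
      Nat.card_pos.ne'
    rw [Finset.card_insert_of_notMem hqN, pow_succ]
    refine mul_right_cancel₀ (mul_ne_zero hW hWs) ?_
    calc Nat.card (𝓕.relaxedAt (insert q N)).selmerGroup *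
          Nat.card (inv.dualSelmerStructure ρ 𝓕).selmerGroup *
          (Nat.card (𝓕.relaxedAt N).selmerGroup *
            Nat.card (inv.dualSelmerStructure ρ (𝓕.relaxedAt N)).selmerGroup)
        = (Nat.card (𝓕.relaxedAt (insert q N)).selmerGroup *
            Nat.card (inv.dualSelmerStructure ρ (𝓕.relaxedAt N)).selmerGroup) *
          (Nat.card (𝓕.relaxedAt N).selmerGroup *
            Nat.card (inv.dualSelmerStructure ρ 𝓕).selmerGroup) := by ring
      _ = (p * Nat.card (𝓕.relaxedAt N).selmerGroup *
            Nat.card (inv.dualSelmerStructure ρ (𝓕.relaxedAt (insert q N))).selmerGroup) *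
          (p ^ N.card * Nat.card 𝓕.selmerGroup *
            Nat.card (inv.dualSelmerStructure ρ (𝓕.relaxedAt N)).selmerGroup) := by rw [step, ih']
      _ = p ^ N.card * p * Nat.card 𝓕.selmerGroup *
          Nat.card (inv.dualSelmerStructure ρ (𝓕.relaxedAt (insert q N))).selmerGroup *
          (Nat.card (𝓕.relaxedAt N).selmerGroup *
            Nat.card (inv.dualSelmerStructure ρ (𝓕.relaxedAt N)).selmerGroup) := by ring

/-- **At core rank one, `#W(N) = p^{#N+1} · #W^*(N)`**; a core-like level (`W^*(N) = 0`) has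
`#W(N) = p^{#N+1}` (Mazur–Rubin Cor. 3.5 (ii) at `r = 1` over a field). [folklore] -/
theorem natCard_selmerGroup_relaxedAt_eq_pow_mul {p : ℕ} [Fact p.Prime] {inv : LocalInvariants K p}
    (hperf : inv.IsPerfect) (hsum : inv.SumLocalTermEqZero) (hcompl : inv.SelmerComplement)
    (hM : ∀ m : M, p • m = 0) {S : Finset (Place K)}
    (hS : ∀ v : HeightOneSpectrum (𝓞 K), (Sum.inr v : Place K) ∉ S →
      ((p : ℕ) : 𝓞 K) ∉ v.asIdeal ∧ GaloisRep.IsUnramifiedAt v ρ)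
    {𝓕 : SelmerStructure ρ} (h𝓕 : 𝓕.IsUnramifiedOutside S)
    (hfin : Finite 𝓕.selmerGroup) (hfind : Finite (inv.dualSelmerStructure ρ 𝓕).selmerGroup)
    (hχ : LocalInvariants.HasCoreRank inv 𝓕 p 1)
    {D : KolyvaginDatum ρ} (hPS : ∀ q ∈ D.primes, (Sum.inr q : Place K) ∉ S)
    (hU : ∀ q ∈ D.primes, Nat.card (unramifiedSubgroup (GaloisRep.toLocal q ρ) 1) = p)
    (hH1 : ∀ q ∈ D.primes, Nat.card (galoisCohomology (GaloisRep.toLocal q ρ) 1) = p ^ 2)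
    {N : Finset (HeightOneSpectrum (𝓞 K))} (hN : D.IsLevel N) :
    Nat.card (𝓕.relaxedAt N).selmerGroup =
      p ^ (N.card + 1) * Nat.card (inv.dualSelmerStructure ρ (𝓕.relaxedAt N)).selmerGroup := by
  have h := natCard_selmerGroup_relaxedAt_mul hperf hsum hcompl hM hS h𝓕 hfin hfind hPS hU hH1 hN
  rw [LocalInvariants.HasCoreRank, pow_one] at hχ
  rw [hχ] at h
  have hFs : Nat.card (inv.dualSelmerStructure ρ 𝓕).selmerGroup ≠ 0 := Nat.card_pos.ne'
  refine mul_right_cancel₀ hFs ?_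
  rw [h]; ring

end Counting

/-! ## §4. Core-like levels exist above every level -/

section CoreLike

variable [Finite M]

/-- **Above every level there is a core-like level** `N ⊇ n`, `H¹_{(𝓕^N)^*}(K, M^D) = 0`: adjoin,
one at a time, primes at which a surviving dual class does not vanish (`hprime'`; Mazur–Rubin JTNB 28
(2016) Lemma 6.4 (ii): "choose `𝔩_i` such that `loc_{𝔩_i}(c_i) ≠ 0`"). [folklore] -/
theorem exists_coreLike_superset {inv : LocalInvariants K n} (hperf : inv.IsPerfect)
    (hM : ∀ m : M, n • m = 0) (𝓕 : SelmerStructure ρ)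
    (hfind : Finite (inv.dualSelmerStructure ρ 𝓕).selmerGroup) (D : KolyvaginDatum ρ)
    (hprime' : ∀ y : galoisCohomology (ρ.tateDual n) 1, y ≠ 0 →
      {q ∈ D.primes | galoisCohomology.localization (ρ.tateDual n) (Sum.inr q) 1 y ≠ 0}.Infinite)
    {n₀ : Finset (HeightOneSpectrum (𝓞 K))} (hn₀ : D.IsLevel n₀) :
    ∃ N : Finset (HeightOneSpectrum (𝓞 K)), n₀ ⊆ N ∧ D.IsLevel N ∧
      (inv.dualSelmerStructure ρ (𝓕.relaxedAt N)).selmerGroup = ⊥ := by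
  classical
  -- induction on the order of the (finite) dual Selmer group of `𝓕^{n}` over all levels `n ⊇ n₀`
  suffices h : ∀ (c : ℕ) (n : Finset (HeightOneSpectrum (𝓞 K))), n₀ ⊆ n → D.IsLevel n →
      Nat.card (inv.dualSelmerStructure ρ (𝓕.relaxedAt n)).selmerGroup = c →
      ∃ N, n₀ ⊆ N ∧ D.IsLevel N ∧ (inv.dualSelmerStructure ρ (𝓕.relaxedAt N)).selmerGroup = ⊥ from
    h _ n₀ subset_rfl hn₀ rfl
  intro c
  induction c using Nat.strong_induction_on with
  | _ c ih =>
    intro n hn₀n hn hc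
    haveI := finite_dualSelmerGroup_relaxedAt inv 𝓕 hfind n
    by_cases hbot : (inv.dualSelmerStructure ρ (𝓕.relaxedAt n)).selmerGroup = ⊥
    · exact ⟨n, hn₀n, hn, hbot⟩
    · obtain ⟨y, hy, hy0⟩ := (AddSubgroup.bot_or_exists_ne_zero _).resolve_left hbot
      obtain ⟨q, ⟨hq, hyq⟩, hqn⟩ := (hprime' y hy0).exists_notMem_finset n
      -- the dual Selmer group of `𝓕^{n𝔮}` is a proper subgroup (it misses `y`)
      have hle : (inv.dualSelmerStructure ρ (𝓕.relaxedAt (insert q n))).selmerGroup ≤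
          (inv.dualSelmerStructure ρ (𝓕.relaxedAt n)).selmerGroup :=
        fun z hz => ((mem_dualSelmerGroup_relaxedAt_insert_iff hperf hM 𝓕 n q z).mp hz).1
      have hne : (inv.dualSelmerStructure ρ (𝓕.relaxedAt (insert q n))).selmerGroup ≠
          (inv.dualSelmerStructure ρ (𝓕.relaxedAt n)).selmerGroup := by
        intro heq
        have hy' := heq ▸ hy
        exact hyq ((mem_dualSelmerGroup_relaxedAt_insert_iff hperf hM 𝓕 n q y).mp hy').2
      have hlt : Nat.card (inv.dualSelmerStructure ρ (𝓕.relaxedAt (insert q n))).selmerGroup < c := by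
        rw [← hc]
        refine lt_of_le_of_ne (AddSubgroup.card_le_of_le hle) fun h => hne ?_
        exact AddSubgroup.eq_of_le_of_card_ge hle h.ge
      exact ih _ hlt (insert q n) (hn₀n.trans (Finset.subset_insert q n)) (hn.insert hq) rfl

end CoreLike

end Summit.BirchSwinnertonDyer.Rank1Residual.GaloisImage.CoreRankOne.Stalk

end
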